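import Literature.Computability.Learning.LearnerFP
import Literature.Computability.Learning.PACUniformCoins
import HarnessLib

/-!
# The coin segment of a run is a uniform sample of the run coins

Analysis instalment (M9a-1) of the decomposition of the named fact
`Literature.Computability.Learning.cikk_natural_implies_learning` (CIKK 2016, Thm. 5.1): the
decoding `coinsToRun` (`LearnerHypFP.lean`) of a coin segment of length `runLen` into the
structured coins `RunCoins n k 2^ℓ (q²) kk t` of one run is a BIJECTION when `k = 2^κ`
(injective field by field; the cardinalities agree), so that counting over uniform coin
segments is counting over uniform run coins (`card_filter_seg_eq`).

## References

* M. Carmosino, R. Impagliazzo, V. Kabanets, A. Kolokolova, *Learning algorithms from natural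
  proofs*, CCC 2016, §5 [CarmosinoImpagliazzoKabanetsKolokolova2016].
-/

namespace Literature.Computability.Learning

open Literature.Computability.Complexity Literature.Computability.MetaComplexity
  Literature.Computability.Cryptography _root_.Computability Finset

section Bij

variable {n k ℓ kk t q κ : ℕ}

/-- **The number of run coins is `2^{runLen}`** (for `k = 2^κ`). [folklore] -/
theorem card_runCoins (hk : k = 2 ^ κ) :
    Fintype.card (RunCoins n k (2 ^ ℓ) (q * q) kk t) = 2 ^ runLen n k ℓ kk t q κ := by
  simp only [RunCoins, AdvCoins, SGCoins, DCCoins, BVec, Fintype.card_prod, Fintype.card_fun, Fintype.card_fin,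
    Fintype.card_bool, ZMod.card, runLen, offSt, offA, offPb, offSg, offSd, offW, stepLen]
  rw [hk, ← pow_add, ← pow_mul]
  simp only [← pow_add]
  ring

/-- `boolToZMod` is injective. [folklore] -/
theorem boolToZMod_inj {b c : Bool} (h : boolToZMod b = boolToZMod c) : b = c := by
  rw [← zmodToBool_boolToZMod b, h, zmodToBool_boolToZMod]

/-- **`coinsToRun` is injective on segments of length `runLen`** (`2^κ ≤ k`). [folklore] -/
theorem coinsToRun_inj (hκ : 2 ^ κ ≤ k) (hk : 0 < k) {s₁ s₂ : List Bool} (h₁ : s₁.length = runLen n k ℓ kk t q κ)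
    (h₂ : s₂.length = runLen n k ℓ kk t q κ)
    (h : coinsToRun n k ℓ kk t q κ hk s₁ = coinsToRun n k ℓ kk t q κ hk s₂) : s₁ = s₂ := by
  have hO : offSt n k ℓ kk q = ℓ + q * q + 2 ^ ℓ + kk * k + kk + k + k * n := rfl
  have hRL : runLen n k ℓ kk t q κ = offSt n k ℓ kk q + t * stepLen n k κ := rfl
  -- the fields of the two decodings agree
  have hi := congrArg (fun ω => ω.1.1) h
  have hz := congrArg (fun ω => ω.1.2.1) h
  have hw := congrArg (fun ω => ω.1.2.2) h
  have hsd := congrArg (fun ω => ω.2.1.1) h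
  have hsg := congrArg (fun ω => ω.2.1.2) h
  have hPb := congrArg (fun ω => ω.2.2.1) h
  have ha := congrArg (fun ω => ω.2.2.2.1) h
  have hst := congrArg (fun ω => ω.2.2.2.2) h
  simp only [coinsToRun] at hi hz hw hsd hsg hPb ha hst
  replace hi := (boolFunEquivFin ℓ).injective hi
  -- compare bit by bit
  apply List.ext_getElem (h₁.trans h₂.symm)
  intro p hp1 hp2
  rw [← List.getD_eq_getElem _ false hp1, ← List.getD_eq_getElem _ false hp2]
  rw [h₁, hRL, hO, stepLen] at hp1
  by_cases c1 : p < ℓ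
  · have := congrFun hi ⟨p, c1⟩
    simp only [readBits, zero_add] at this
    exact this
  by_cases c2 : p < ℓ + q * q
  · have := congrFun hz ⟨p - ℓ, by omega⟩
    simp only [readBits] at this
    rwa [show ℓ + (p - ℓ) = p by omega] at this
  by_cases c3 : p < ℓ + q * q + 2 ^ ℓ
  · have := congrFun hw ⟨p - (ℓ + q * q), by omega⟩
    simp only [readBits, offW] at this
    rwa [show ℓ + q * q + (p - (ℓ + q * q)) = p by omega] at this
  by_cases c4 : p < ℓ + q * q + 2 ^ ℓ + kk * k
  · set idx := p - (ℓ + q * q + 2 ^ ℓ) with hidx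
    have hlt : idx < kk * k := by omega
    have hs : idx / k < kk := Nat.div_lt_of_lt_mul (by rwa [mul_comm] at hlt)
    have := congrFun (congrFun hsd ⟨idx / k, hs⟩) ⟨idx % k, Nat.mod_lt _ hk⟩
    simp only [Nat.div_add_mod'] at this
    have hb := boolToZMod_inj this
    rw [getD_slice hlt, getD_slice hlt, offSd, offW, show ℓ + q * q + 2 ^ ℓ + idx = p by omega] at hb
    exact hb
  by_cases c5 : p < ℓ + q * q + 2 ^ ℓ + kk * k + kk
  · have hlt : p - (ℓ + q * q + 2 ^ ℓ + kk * k) < kk := by omega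
    have := congrFun hsg ⟨p - (ℓ + q * q + 2 ^ ℓ + kk * k), hlt⟩
    have hb := boolToZMod_inj this
    rw [getD_slice hlt, getD_slice hlt, offSg, offSd, offW,
      show ℓ + q * q + 2 ^ ℓ + kk * k + (p - (ℓ + q * q + 2 ^ ℓ + kk * k)) = p by omega] at hb
    exact hb
  by_cases c6 : p < ℓ + q * q + 2 ^ ℓ + kk * k + kk + k
  · have := congrFun hPb ⟨p - (ℓ + q * q + 2 ^ ℓ + kk * k + kk), by omega⟩
    simp only [readBits, offPb, offSg, offSd, offW] at this
    rwa [show ℓ + q * q + 2 ^ ℓ + kk * k + kk + (p - (ℓ + q * q + 2 ^ ℓ + kk * k + kk)) = p by omega] at this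
  by_cases c7 : p < ℓ + q * q + 2 ^ ℓ + kk * k + kk + k + k * n
  · set idx := p - (ℓ + q * q + 2 ^ ℓ + kk * k + kk + k) with hidx
    have hlt : idx < k * n := by omega
    have hn : 0 < n := Nat.pos_of_ne_zero fun h0 => by rw [h0, mul_zero] at hlt; exact Nat.not_lt_zero _ hlt
    have hb' : idx / n < k := Nat.div_lt_of_lt_mul (by rwa [mul_comm] at hlt)
    have := congrFun (congrFun ha ⟨idx / n, hb'⟩) ⟨idx % n, Nat.mod_lt _ hn⟩
    simp only [Nat.div_add_mod'] at this
    rw [getD_slice hlt, getD_slice hlt, offA, offPb, offSg, offSd, offW,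
      show ℓ + q * q + 2 ^ ℓ + kk * k + kk + k + idx = p by omega] at this
    exact this
  · -- the steps
    set idx := p - (ℓ + q * q + 2 ^ ℓ + kk * k + kk + k + k * n) with hidx
    have hlt : idx < t * (κ + k * n) := by omega
    have hsl : 0 < κ + k * n := Nat.pos_of_ne_zero fun h0 => by rw [h0, mul_zero] at hlt; exact Nat.not_lt_zero _ hlt
    have hr : idx / (κ + k * n) < t := Nat.div_lt_of_lt_mul (by rwa [mul_comm] at hlt)
    have hsteq := congrFun hst ⟨idx / (κ + k * n), hr⟩
    simp only [Prod.mk.injEq, Fin.mk.injEq] at hsteq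
    obtain ⟨hj, hy⟩ := hsteq
    set rr := idx / (κ + k * n) with hrr
    set u := idx % (κ + k * n) with hu
    have hru : rr * (κ + k * n) + u = idx := Nat.div_add_mod' idx (κ + k * n)
    have hfit : rr * (κ + k * n) + (κ + k * n) ≤ t * (κ + k * n) := by
      have := Nat.mul_le_mul_right (κ + k * n) hr; rw [Nat.succ_mul] at this; exact this
    by_cases cu : u < κ
    · -- the `j` bits
      have hb1 : bitsToNat (List.ofFn (readBits (slice s₁ (offSt n k ℓ kk q) (t * stepLen n k κ)) (rr * stepLen n k κ) κ)) < k :=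
        lt_of_lt_of_le (by simpa using bitsToNat_lt (List.ofFn (readBits (slice s₁ (offSt n k ℓ kk q) (t * stepLen n k κ)) (rr * stepLen n k κ) κ))) hκ
      have hb2 : bitsToNat (List.ofFn (readBits (slice s₂ (offSt n k ℓ kk q) (t * stepLen n k κ)) (rr * stepLen n k κ) κ)) < k :=
        lt_of_lt_of_le (by simpa using bitsToNat_lt (List.ofFn (readBits (slice s₂ (offSt n k ℓ kk q) (t * stepLen n k κ)) (rr * stepLen n k κ) κ))) hκ
      rw [Nat.mod_eq_of_lt hb1, Nat.mod_eq_of_lt hb2] at hj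
      have hlists := List.ofFn_injective (bitsToNat_injOn_length (by simp) hj)
      have := congrFun hlists ⟨u, cu⟩
      simp only [readBits] at this
      have hidx' : rr * stepLen n k κ + u < t * stepLen n k κ := by rw [stepLen]; omega
      rw [getD_slice hidx', getD_slice hidx', hO,
        show ℓ + q * q + 2 ^ ℓ + kk * k + kk + k + k * n + (rr * stepLen n k κ + u) = p by rw [stepLen]; omega] at this
      exact this
    · -- the `y` bits
      rw [not_lt] at cu
      set idx' := u - κ with hidx'
      have hlt' : idx' < k * n := by have := Nat.mod_lt idx hsl; omega
      have hn : 0 < n := Nat.pos_of_ne_zero fun h0 => by rw [h0, mul_zero] at hlt'; exact Nat.not_lt_zero _ hlt'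
      have hb' : idx' / n < k := Nat.div_lt_of_lt_mul (by rwa [mul_comm] at hlt')
      have := congrFun (congrFun hy ⟨idx' / n, hb'⟩) ⟨idx' % n, Nat.mod_lt _ hn⟩
      simp only [Nat.div_add_mod'] at this
      have hidx2 : rr * stepLen n k κ + κ + idx' < t * stepLen n k κ := by rw [stepLen]; omega
      rw [getD_slice hidx2, getD_slice hidx2, hO,
        show ℓ + q * q + 2 ^ ℓ + kk * k + kk + k + k * n + (rr * stepLen n k κ + κ + idx') = p by rw [stepLen]; omega] at this
      exact this

/-- **The decoding of coin segments is a bijection onto the run coins** (`k = 2^κ`).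
[folklore] -/
theorem coinsToRun_ofFn_bijective (hk' : k = 2 ^ κ) (hk : 0 < k) :
    Function.Bijective fun v : Fin (runLen n k ℓ kk t q κ) → Bool => coinsToRun n k ℓ kk t q κ hk (List.ofFn v) := by
  rw [Fintype.bijective_iff_injective_and_card, Fintype.card_fun, Fintype.card_fin, Fintype.card_bool, card_runCoins hk']
  refine ⟨fun v w hvw => ?_, rfl⟩
  have := coinsToRun_inj (le_of_eq hk'.symm) hk (by simp) (by simp) hvw
  exact List.ofFn_injective this

/-- **The run-coin equivalence**: coin segments of length `runLen` ≃ `RunCoins`. [folklore] -/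
noncomputable def segEquiv (hk' : k = 2 ^ κ) (hk : 0 < k) :
    (Fin (runLen n k ℓ kk t q κ) → Bool) ≃ RunCoins n k (2 ^ ℓ) (q * q) kk t :=
  Equiv.ofBijective _ (coinsToRun_ofFn_bijective hk' hk)

/-- The equivalence is the decoding. [folklore] -/
theorem segEquiv_apply (hk' : k = 2 ^ κ) (hk : 0 < k) (v : Fin (runLen n k ℓ kk t q κ) → Bool) :
    segEquiv hk' hk v = coinsToRun n k ℓ kk t q κ hk (List.ofFn v) := rfl

/-- **Counting over uniform coin segments is counting over uniform run coins.** [folklore] -/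
theorem card_filter_seg_eq (hk' : k = 2 ^ κ) (hk : 0 < k) (P : RunCoins n k (2 ^ ℓ) (q * q) kk t → Prop) [DecidablePred P] :
    (univ.filter fun v : Fin (runLen n k ℓ kk t q κ) → Bool => P (coinsToRun n k ℓ kk t q κ hk (List.ofFn v))).card =
      (univ.filter P).card := by
  rw [← Finset.card_map (segEquiv hk' hk).toEmbedding]
  congr 1
  ext ω
  simp only [Finset.mem_map_equiv, Finset.mem_filter, Finset.mem_univ, true_and]
  constructor
  · intro h
    rwa [show (segEquiv hk' hk).symm ω = (segEquiv hk' hk).symm ω from rfl, ← segEquiv_apply hk' hk, Equiv.apply_symm_apply] at h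
  · intro h
    rw [← segEquiv_apply hk' hk, Equiv.apply_symm_apply]
    exact h

end Bij

end Literature.Computability.Learning
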